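import Literature.Analysis.FluidPDE.OnsagerBDSVStages
import Literature.Analysis.FluidPDE.OnsagerFlexibilityProofs
import HarnessLib

/-!
# The BDSV scheme: parameter inequalities (§2.3 and the proof of Prop. 2.1 in §2.6)

Buckmaster–De Lellis–Székelyhidi–Vicol (BDSV), *Onsager's conjecture for admissible weak
solutions*, CPAM 72 (2019) = arXiv:1701.08678, run their scheme with frequencies
`λ_q = 2π⌈a^{b^q}⌉` and amplitudes `δ_q = λ_q^{-2β}` (§2.1; `BDSV.freq`, `BDSV.amp` of
`OnsagerBDSV.lean`) and repeatedly use that any fixed inequality between monomials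
`λ_q^x λ_{q+1}^y λ_{q+2}^z` whose "`a`-exponent" `x + b y + b² z` is negative holds, uniformly in
`q`, once `a` is large ("one divides …, takes logarithms and divides by `log λ_q`", §2.6, proof of
(2.25); "`a` is large enough to absorb any constant appearing from the ratio `λ_q / a^{b^q}`, for
which we have the elementary bounds (2.9) `2π ≤ λ_q / a^{b^q} ≤ 4π`", §2.3). This file proves:

* (2.9): `λ_q ≤ 4π a^{b^q}` (`freq_le_four_pi_mul_rpow`), hence `λ_q^x ≤ (4π)^{|x|} a^{x b^q}` for
  every real `x` (`freq_rpow_le`), and the monotonicity `λ_q ≤ λ_{q+1}`;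
* the **master lemma** `exists_freq_triple_le`: if `x + b y + b² z < 0` then for every `K` there
  is `a₁ > 1` with `K λ_q^x λ_{q+1}^y λ_{q+2}^z ≤ 1` for all `a ≥ a₁` and all `q`;
* (2.11), upper half: `ℓ ≤ λ_q^{-1}` for the mollification length `ℓ = BDSV.mollScale`
  (`mollScale_le_freq_inv`), valid for all `a ≥ 1`;
* the six parameter inequalities used in the "Proof of Proposition 2.1" (§2.6), in the form in
  which the assembly `OnsagerBDSVStagesProofs.lean` consumes them (`exists_mainThreshold`): for
  `0 < β < 1/3`, `1 < b < (1-β)/(2β)` (2.1)′, `0 < α < -E₀/(8b)` where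
  `E₀ = (2βb - (1-β))(b-1) < 0` is the left side of (2.26) at `α = 0`, any `C` and `M > 0`, and
  all `a` beyond a threshold: `C λ_q^{-α} ≤ M/16`, `(3C+2M) δ_q^{1/2} λ_q ≤ (M/4) δ_{q+1}^{1/2} λ_{q+1}`,
  `(M+1) δ_{q+1}^{1/2} ≤ δ_q^{1/2}`, the stress inequality
  `C δ_{q+1}^{1/2} δ_q^{1/2} λ_q λ_{q+1}^{4α-1} ≤ δ_{q+2} λ_{q+1}^{-3α}` and the energy inequality
  `C δ_q^{1/2} δ_{q+1}^{1/2} λ_q^{1+2α} λ_{q+1}^{-1} ≤ δ_{q+2}/4` (both instances of (2.25):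
  `δ_q^{1/2} δ_{q+1}^{1/2} λ_q λ_{q+1}^{-1} ≤ δ_{q+2} λ_{q+1}^{-8α}`), and `λ_{q+1}^{-α} ≤ 1/4`.

## Design choices

* Everything is stated for real `a ≥ 1`, `b ≥ 1` (the scheme has `a ≫ 1`, `b > 1`); thresholds
  are produced as `∃ a₁ > 1, ∀ a ≥ a₁, ∀ q`.
* The algebra (2.25) ⇔ (2.26) is carried out on the exponent `x + b y + b² z` once, in the master
  lemma; the specific inequalities are then obtained by multiplying through by positive monomials.

## References

* T. Buckmaster, C. De Lellis, L. Székelyhidi Jr., V. Vicol, *Onsager's conjecture for admissible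
  weak solutions*, Comm. Pure Appl. Math. 72 (2019) 229–274 = arXiv:1701.08678: §2.1 (parameters),
  §2.3 (2.8)–(2.9), §2.4 (2.10)–(2.11), §2.6 "Proof of Proposition 2.1" with (2.25)–(2.26).
-/

open Set

noncomputable section

namespace Literature.Analysis.FluidPDE

namespace BDSV

/-! ## Growth of `λ_q`: the elementary bounds (2.9) and their consequences -/

section Growth

variable {a b : ℝ}

/-- `⌈x⌉ ≤ 2x` for real `x ≥ 1`. [folklore] -/
theorem int_ceil_le_two_mul {x : ℝ} (hx : 1 ≤ x) : (⌈x⌉ : ℝ) ≤ 2 * x := by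
  have h := Int.ceil_lt_add_one x
  linarith

/-- The upper elementary bound (2.9): `λ_q ≤ 4π a^{b^q}` for `a, b ≥ 1` (since `⌈y⌉ ≤ 2y` for
`y = a^{b^q} ≥ 1`). [cite: BuckmasterEtAl2018, §2.3 (2.9)] -/
theorem freq_le_four_pi_mul_rpow (ha : 1 ≤ a) (hb : 1 ≤ b) (q : ℕ) :
    freq a b q ≤ 4 * Real.pi * a ^ (b ^ q) := by
  have hb0 : (0 : ℝ) ≤ b := by linarith
  have h1 : (1 : ℝ) ≤ a ^ (b ^ q) := Real.one_le_rpow ha (pow_nonneg hb0 q)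
  have h2 : (⌈a ^ (b ^ q)⌉ : ℝ) ≤ 2 * a ^ (b ^ q) := int_ceil_le_two_mul h1
  unfold freq
  nlinarith [Real.pi_pos]

/-- `λ_q ≤ λ_{q+1}` for `a, b ≥ 1`. [folklore] -/
theorem freq_le_freq_succ (ha : 1 ≤ a) (hb : 1 ≤ b) (q : ℕ) : freq a b q ≤ freq a b (q + 1) := by
  have hb0 : (0 : ℝ) ≤ b := by linarith
  have h1 : b ^ q ≤ b ^ (q + 1) := by
    rw [pow_succ]
    exact le_mul_of_one_le_right (pow_nonneg hb0 q) hb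
  have h2 : a ^ (b ^ q) ≤ a ^ (b ^ (q + 1)) := Real.rpow_le_rpow_of_exponent_le ha h1
  have h3 : (⌈a ^ (b ^ q)⌉ : ℝ) ≤ (⌈a ^ (b ^ (q + 1))⌉ : ℝ) := by
    exact_mod_cast Int.ceil_le_ceil h2
  unfold freq
  exact mul_le_mul_of_nonneg_left h3 (by positivity)

/-- `δ_{q+1}^{1/2} ≤ δ_q^{1/2}` for `a, b ≥ 1`, `β ≥ 0`. [folklore] -/
theorem sqrt_amp_succ_le {β : ℝ} (ha : 1 ≤ a) (hb : 1 ≤ b) (hβ : 0 ≤ β) (q : ℕ) :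
    Real.sqrt (amp β a b (q + 1)) ≤ Real.sqrt (amp β a b q) := by
  rw [sqrt_amp ha, sqrt_amp ha]
  exact Real.rpow_le_rpow_of_nonpos (freq_pos ha q) (freq_le_freq_succ ha hb q) (by linarith)

/-- **Powers of `λ_q` against powers of `a`**: `λ_q^x ≤ (4π)^{|x|} a^{b^q x}` for every real `x`
and `a, b ≥ 1` (from `a^{b^q} ≤ λ_q ≤ 4π a^{b^q}`, (2.9)). [cite: BuckmasterEtAl2018, §2.3 (2.9)] -/
theorem freq_rpow_le (ha : 1 ≤ a) (hb : 1 ≤ b) (q : ℕ) (x : ℝ) :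
    freq a b q ^ x ≤ (4 * Real.pi) ^ |x| * a ^ (b ^ q * x) := by
  have ha0 : (0 : ℝ) ≤ a := by linarith
  have hf := freq_pos (b := b) ha q
  have hA : 0 < a ^ (b ^ q) := Real.rpow_pos_of_pos (by linarith) _
  have h4π : (1 : ℝ) ≤ 4 * Real.pi := by linarith [Real.two_le_pi]
  rw [Real.rpow_mul ha0]
  rcases le_or_gt 0 x with hx | hx
  · rw [abs_of_nonneg hx, ← Real.mul_rpow (by positivity) hA.le]
    exact Real.rpow_le_rpow hf.le (freq_le_four_pi_mul_rpow ha hb q) hx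
  · rw [abs_of_neg hx]
    calc freq a b q ^ x ≤ (a ^ (b ^ q)) ^ x :=
          Real.rpow_le_rpow_of_nonpos hA (rpow_pow_le_freq ha0 b q) hx.le
      _ = 1 * (a ^ (b ^ q)) ^ x := (one_mul _).symm
      _ ≤ (4 * Real.pi) ^ (-x) * (a ^ (b ^ q)) ^ x := by
          gcongr
          exact Real.one_le_rpow h4π (by linarith)

/-- **Master parameter lemma** (the mechanism behind (2.25) ⇐ (2.26), §2.6: "one divides by the
right hand side, takes logarithms and divides by `log λ_q`"). If the `a`-exponent
`E = x + b y + b² z` of the monomial `λ_q^x λ_{q+1}^y λ_{q+2}^z` is negative, then for every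
constant `K` there is a threshold `a₁ > 1` such that `K λ_q^x λ_{q+1}^y λ_{q+2}^z ≤ 1` for all
`a ≥ a₁` and all `q ∈ ℕ`: indeed the monomial is at most `(4π)^{|x|+|y|+|z|} a^{b^q E} ≤ (4π)^{…} a^E`.
[cite: BuckmasterEtAl2018, §2.6 (2.25)–(2.26)] -/
theorem exists_freq_triple_le (hb : 1 ≤ b) {x y z : ℝ} (hE : x + b * y + b ^ 2 * z < 0) (K : ℝ) :
    ∃ a₁ : ℝ, 1 < a₁ ∧ ∀ a : ℝ, a₁ ≤ a → ∀ q : ℕ,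
      K * (freq a b q ^ x * freq a b (q + 1) ^ y * freq a b (q + 2) ^ z) ≤ 1 := by
  set E : ℝ := x + b * y + b ^ 2 * z with hE_def
  have hE0 : E ≠ 0 := ne_of_lt hE
  have h4π0 : (0 : ℝ) < 4 * Real.pi := by positivity
  set L : ℝ := (4 * Real.pi) ^ (|x| + |y| + |z|) with hL_def
  have hL : 0 < L := Real.rpow_pos_of_pos h4π0 _
  set K' : ℝ := max K 0 * L + 1 with hK'_def
  have hKL : 0 ≤ max K 0 * L := mul_nonneg (le_max_right _ _) hL.le
  have hK'0 : 0 < K' := by linarith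
  refine ⟨max 2 (K' ^ (-1 / E)), lt_max_of_lt_left one_lt_two, fun a ha q => ?_⟩
  have ha2 : (2 : ℝ) ≤ a := le_trans (le_max_left _ _) ha
  have ha1 : (1 : ℝ) ≤ a := by linarith
  have ha0 : (0 : ℝ) < a := by linarith
  have hf0 := freq_pos (b := b) ha1 q
  have hf1 := freq_pos (b := b) ha1 (q + 1)
  have hf2 := freq_pos (b := b) ha1 (q + 2)
  have hP0 : 0 ≤ freq a b q ^ x * freq a b (q + 1) ^ y * freq a b (q + 2) ^ z := by positivity
  rcases le_or_gt K 0 with hK | hK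
  · exact le_trans (mul_nonpos_iff.2 (Or.inr ⟨hK, hP0⟩)) zero_le_one
  · have hKmax : max K 0 = K := max_eq_left hK.le
    -- the monomial against a power of `a`
    have hprod : freq a b q ^ x * freq a b (q + 1) ^ y * freq a b (q + 2) ^ z ≤
        L * a ^ (b ^ q * E) := by
      have hx := freq_rpow_le ha1 hb q x
      have hy := freq_rpow_le ha1 hb (q + 1) y
      have hz := freq_rpow_le ha1 hb (q + 2) z
      have e1 : a ^ (b ^ q * x) * a ^ (b ^ (q + 1) * y) * a ^ (b ^ (q + 2) * z) =
          a ^ (b ^ q * E) := by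
        rw [← Real.rpow_add ha0, ← Real.rpow_add ha0, hE_def]
        congr 1
        ring
      have e2 : (4 * Real.pi) ^ |x| * (4 * Real.pi) ^ |y| * (4 * Real.pi) ^ |z| = L := by
        rw [hL_def, Real.rpow_add h4π0, Real.rpow_add h4π0]
      calc freq a b q ^ x * freq a b (q + 1) ^ y * freq a b (q + 2) ^ z
          ≤ ((4 * Real.pi) ^ |x| * a ^ (b ^ q * x)) * ((4 * Real.pi) ^ |y| * a ^ (b ^ (q + 1) * y)) *
              ((4 * Real.pi) ^ |z| * a ^ (b ^ (q + 2) * z)) := by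
            gcongr
        _ = ((4 * Real.pi) ^ |x| * (4 * Real.pi) ^ |y| * (4 * Real.pi) ^ |z|) *
              (a ^ (b ^ q * x) * a ^ (b ^ (q + 1) * y) * a ^ (b ^ (q + 2) * z)) := by ring
        _ = L * a ^ (b ^ q * E) := by rw [e1, e2]
    -- `a^{b^q E} ≤ a^E ≤ K'⁻¹`
    have hbq : (1 : ℝ) ≤ b ^ q := one_le_pow₀ hb
    have hexp : b ^ q * E ≤ E := by nlinarith
    have h1 : a ^ (b ^ q * E) ≤ a ^ E := Real.rpow_le_rpow_of_exponent_le ha1 hexp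
    have hKa : K' ^ (-1 / E) ≤ a := le_trans (le_max_right _ _) ha
    have h2 : a ^ E ≤ (K' ^ (-1 / E)) ^ E :=
      Real.rpow_le_rpow_of_nonpos (Real.rpow_pos_of_pos hK'0 _) hKa hE.le
    have h3 : (K' ^ (-1 / E)) ^ E = K'⁻¹ := by
      rw [← Real.rpow_mul hK'0.le, show (-1 / E) * E = -1 by field_simp, Real.rpow_neg_one]
    have h4 : a ^ (b ^ q * E) ≤ K'⁻¹ := h1.trans (h3 ▸ h2)
    calc K * (freq a b q ^ x * freq a b (q + 1) ^ y * freq a b (q + 2) ^ z)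
        ≤ K * (L * K'⁻¹) := by
          refine mul_le_mul_of_nonneg_left (hprod.trans ?_) hK.le
          exact mul_le_mul_of_nonneg_left h4 hL.le
      _ = (K * L) / K' := by ring
      _ ≤ 1 := by
          rw [div_le_one hK'0, hK'_def, hKmax]
          linarith

end Growth

/-! ## The mollification length: (2.11), upper half -/

section MollScale

variable {β α a b : ℝ}

/-- `ℓ` in terms of the frequencies: `ℓ = λ_{q+1}^{-β} / (λ_q^{-β} λ_q^{1+3α/2})` for `a ≥ 1`.
[folklore] -/
theorem mollScale_eq (ha : 1 ≤ a) (q : ℕ) :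
    mollScale β α a b q =
      freq a b (q + 1) ^ (-β) / (freq a b q ^ (-β) * freq a b q ^ (1 + 3 * α / 2)) := by
  rw [mollScale, sqrt_amp ha, sqrt_amp ha]

/-- (2.11), upper half: `ℓ ≤ λ_q^{-1}`, for all `a, b ≥ 1`, `β, α ≥ 0` (since `λ_{q+1} ≥ λ_q ≥ 1`:
`ℓ = (λ_q/λ_{q+1})^β λ_q^{-1-3α/2} ≤ λ_q^{-1}`). [cite: BuckmasterEtAl2018, §2.4 (2.11)] -/
theorem mollScale_le_freq_inv (ha : 1 ≤ a) (hb : 1 ≤ b) (hβ : 0 ≤ β) (hα : 0 ≤ α) (q : ℕ) :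
    mollScale β α a b q ≤ (freq a b q)⁻¹ := by
  have hf := freq_pos (b := b) ha q
  rw [mollScale_eq ha, div_le_iff₀ (by positivity)]
  calc freq a b (q + 1) ^ (-β) ≤ freq a b q ^ (-β) :=
        Real.rpow_le_rpow_of_nonpos hf (freq_le_freq_succ ha hb q) (by linarith)
    _ ≤ freq a b q ^ ((-1) + ((-β) + (1 + 3 * α / 2))) :=
        Real.rpow_le_rpow_of_exponent_le (one_le_freq ha q) (by linarith)
    _ = (freq a b q)⁻¹ * (freq a b q ^ (-β) * freq a b q ^ (1 + 3 * α / 2)) := by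
        rw [Real.rpow_add hf, Real.rpow_add hf, Real.rpow_neg_one]

/-- Consequently `ℓ^α ≤ λ_q^{-α}` for `α ≥ 0` (used in §2.6 to compare the contributions of
(2.12) and (2.18)). [folklore] -/
theorem mollScale_rpow_le (ha : 1 ≤ a) (hb : 1 ≤ b) (hβ : 0 ≤ β) (hα : 0 ≤ α) (q : ℕ) :
    mollScale β α a b q ^ α ≤ freq a b q ^ (-α) := by
  have hf := freq_pos (b := b) ha q
  calc mollScale β α a b q ^ α ≤ ((freq a b q)⁻¹) ^ α :=
        Real.rpow_le_rpow (mollScale_pos ha q).le (mollScale_le_freq_inv ha hb hβ hα q) hα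
    _ = freq a b q ^ (-α) := by rw [Real.inv_rpow hf.le, Real.rpow_neg hf.le]

end MollScale

/-! ## The parameter inequalities of the proof of Prop. 2.1 (§2.6) -/

section Thresholds

variable {β b α M C : ℝ}

/-- `f^u · f = f^{u+1}` for `f > 0`. [folklore] -/
theorem rpow_mul_self_eq {f : ℝ} (hf : 0 < f) (u : ℝ) : f ^ u * f = f ^ (u + 1) := by
  rw [Real.rpow_add hf, Real.rpow_one]

/-- Absorbing the constants of (2.12), (2.18) (§2.6: "`C δ_{q+1}^{1/2} ℓ^α`"): for `α > 0`,
`M > 0` and any `C`, `C λ_q^{-α} ≤ M/16` for all `q` once `a` is large.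
[cite: BuckmasterEtAl2018, §2.6 (Proof of Proposition 2.1)] -/
theorem exists_threshold_rpow_neg (hb : 1 ≤ b) (hα : 0 < α) (hM : 0 < M) (C : ℝ) :
    ∃ a₁ : ℝ, 1 < a₁ ∧ ∀ a : ℝ, a₁ ≤ a → ∀ q : ℕ, C * freq a b q ^ (-α) ≤ M / 16 := by
  obtain ⟨a₁, ha₁, h⟩ := exists_freq_triple_le hb (x := -α) (y := 0) (z := 0)
    (by nlinarith) (16 * C / M)
  refine ⟨a₁, ha₁, fun a ha q => ?_⟩
  have key := h a ha q
  rw [Real.rpow_zero, Real.rpow_zero, mul_one, mul_one] at key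
  have := mul_le_mul_of_nonneg_left key (by positivity : (0 : ℝ) ≤ M / 16)
  calc C * freq a b q ^ (-α) = M / 16 * (16 * C / M * freq a b q ^ (-α)) := by
        field_simp
    _ ≤ M / 16 * 1 := this
    _ = M / 16 := mul_one _

/-- The lower energy bound needs `λ_{q+1}^{-α} ≤ 1/4` (§2.6: (2.6) from (2.24c), "an entirely
analogous argument"), valid for all `q` once `a` is large. [cite: BuckmasterEtAl2018, §2.6] -/
theorem exists_threshold_rpow_neg_succ (hb : 1 ≤ b) (hα : 0 < α) :
    ∃ a₁ : ℝ, 1 < a₁ ∧ ∀ a : ℝ, a₁ ≤ a → ∀ q : ℕ, freq a b (q + 1) ^ (-α) ≤ 1 / 4 := by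
  obtain ⟨a₁, ha₁, h⟩ := exists_freq_triple_le hb (x := 0) (y := -α) (z := 0)
    (by nlinarith) 4
  refine ⟨a₁, ha₁, fun a ha q => ?_⟩
  have key := h a ha q
  rw [Real.rpow_zero, Real.rpow_zero, mul_one, one_mul] at key
  linarith

/-- (2.5) at stage `q+1` needs `(M+1) δ_{q+1}^{1/2} ≤ δ_q^{1/2}` (§2.6:
"`‖v_{q+1}‖₀ ≤ 1 - δ_q^{1/2} + M δ_{q+1}^{1/2}`"), i.e. `(M+1) λ_q^β λ_{q+1}^{-β} ≤ 1`, whose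
`a`-exponent `β(1-b)` is negative. [cite: BuckmasterEtAl2018, §2.6 (Proof of Proposition 2.1)] -/
theorem exists_threshold_sqrt_amp (hβ : 0 < β) (hb : 1 < b) (M : ℝ) :
    ∃ a₁ : ℝ, 1 < a₁ ∧ ∀ a : ℝ, a₁ ≤ a → ∀ q : ℕ,
      (M + 1) * Real.sqrt (amp β a b (q + 1)) ≤ Real.sqrt (amp β a b q) := by
  obtain ⟨a₁, ha₁, h⟩ := exists_freq_triple_le hb.le (x := β) (y := -β) (z := 0)
    (by nlinarith) (M + 1)
  refine ⟨a₁, ha₁, fun a ha q => ?_⟩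
  have ha1 : (1 : ℝ) ≤ a := by linarith
  have hf0 := freq_pos (b := b) ha1 q
  have key := h a ha q
  rw [Real.rpow_zero, mul_one] at key
  rw [sqrt_amp ha1, sqrt_amp ha1]
  have h0 : 0 < freq a b q ^ (-β) := Real.rpow_pos_of_pos hf0 _
  have e1 : freq a b q ^ β * freq a b q ^ (-β) = 1 := by
    rw [← Real.rpow_add hf0, add_neg_cancel, Real.rpow_zero]
  calc (M + 1) * freq a b (q + 1) ^ (-β)
      = (M + 1) * (freq a b q ^ β * freq a b (q + 1) ^ (-β)) * freq a b q ^ (-β) := by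
        rw [show (M + 1) * (freq a b q ^ β * freq a b (q + 1) ^ (-β)) * freq a b q ^ (-β) =
          (M + 1) * freq a b (q + 1) ^ (-β) * (freq a b q ^ β * freq a b q ^ (-β)) by ring, e1,
          mul_one]
    _ ≤ 1 * freq a b q ^ (-β) := mul_le_mul_of_nonneg_right key h0.le
    _ = freq a b q ^ (-β) := one_mul _

/-- (2.4) and (2.7) at stage `q+1` need the low-frequency contributions
`δ_q^{1/2} λ_q` to be small against `δ_{q+1}^{1/2} λ_{q+1}` (§2.6: the terms
`C δ_q^{1/2} λ_q λ_{q+1}^{-1}`): `(3C+2M) δ_q^{1/2} λ_q ≤ (M/4) δ_{q+1}^{1/2} λ_{q+1}`, whose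
`a`-exponent `(1-β)(1-b)` is negative. [cite: BuckmasterEtAl2018, §2.6 (Proof of Proposition 2.1)] -/
theorem exists_threshold_velocity (hβ1 : β < 1) (hb : 1 < b) (hM : 0 < M) (C : ℝ) :
    ∃ a₁ : ℝ, 1 < a₁ ∧ ∀ a : ℝ, a₁ ≤ a → ∀ q : ℕ,
      (3 * C + 2 * M) * (Real.sqrt (amp β a b q) * freq a b q) ≤
        M / 4 * (Real.sqrt (amp β a b (q + 1)) * freq a b (q + 1)) := by
  obtain ⟨a₁, ha₁, h⟩ := exists_freq_triple_le hb.le (x := 1 - β) (y := β - 1) (z := 0)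
    (by nlinarith) (4 * (3 * C + 2 * M) / M)
  refine ⟨a₁, ha₁, fun a ha q => ?_⟩
  have ha1 : (1 : ℝ) ≤ a := by linarith
  have hf0 := freq_pos (b := b) ha1 q
  have hf1 := freq_pos (b := b) ha1 (q + 1)
  have key := h a ha q
  rw [Real.rpow_zero, mul_one] at key
  rw [sqrt_amp ha1, sqrt_amp ha1, rpow_mul_self_eq hf0, rpow_mul_self_eq hf1]
  have hW : 0 < M / 4 * freq a b (q + 1) ^ (-β + 1) := by positivity
  have e1 : freq a b (q + 1) ^ (β - 1) * freq a b (q + 1) ^ (-β + 1) = 1 := by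
    rw [← Real.rpow_add hf1, show β - 1 + (-β + 1) = 0 by ring, Real.rpow_zero]
  calc (3 * C + 2 * M) * freq a b q ^ (-β + 1)
      = (4 * (3 * C + 2 * M) / M * (freq a b q ^ (1 - β) * freq a b (q + 1) ^ (β - 1))) *
          (M / 4 * freq a b (q + 1) ^ (-β + 1)) := by
        rw [show -β + 1 = 1 - β by ring]
        calc (3 * C + 2 * M) * freq a b q ^ (1 - β)
            = (3 * C + 2 * M) * freq a b q ^ (1 - β) *
                (freq a b (q + 1) ^ (β - 1) * freq a b (q + 1) ^ (-β + 1)) := by rw [e1, mul_one]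
          _ = _ := by
            rw [show -β + 1 = 1 - β by ring]
            field_simp
    _ ≤ 1 * (M / 4 * freq a b (q + 1) ^ (-β + 1)) := mul_le_mul_of_nonneg_right key hW.le
    _ = M / 4 * freq a b (q + 1) ^ (-β + 1) := one_mul _

/-- (2.3) at stage `q+1` from (2.24) = (6.1) (§2.6: "(2.3) … follow as a consequence of the
parameter inequality (2.25)"): if the `a`-exponent `(1-β) + b(-1-β+7α) + 2βb²` (the left side of
(2.26) with `7α` in place of `8α`) is negative, then
`C δ_{q+1}^{1/2} δ_q^{1/2} λ_q λ_{q+1}^{-1+4α} ≤ δ_{q+2} λ_{q+1}^{-3α}` for all `q` once `a` is large.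
[cite: BuckmasterEtAl2018, §2.6 (2.25)–(2.26)] -/
theorem exists_threshold_stress (hb : 1 ≤ b)
    (hE : (1 - β) + b * (-1 - β + 7 * α) + b ^ 2 * (2 * β) < 0) (C : ℝ) :
    ∃ a₁ : ℝ, 1 < a₁ ∧ ∀ a : ℝ, a₁ ≤ a → ∀ q : ℕ,
      C * (Real.sqrt (amp β a b (q + 1)) * Real.sqrt (amp β a b q) * freq a b q *
          freq a b (q + 1) ^ (-1 + 4 * α)) ≤
        amp β a b (q + 1 + 1) * freq a b (q + 1) ^ (-3 * α) := by
  obtain ⟨a₁, ha₁, h⟩ := exists_freq_triple_le hb hE C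
  refine ⟨a₁, ha₁, fun a ha q => ?_⟩
  have ha1 : (1 : ℝ) ≤ a := by linarith
  have hf0 := freq_pos (b := b) ha1 q
  have hf1 := freq_pos (b := b) ha1 (q + 1)
  have hf2 := freq_pos (b := b) ha1 (q + 2)
  have key := h a ha q
  rw [sqrt_amp ha1, sqrt_amp ha1, show q + 1 + 1 = q + 2 from rfl]
  unfold amp
  have hW : 0 < freq a b (q + 2) ^ (-2 * β) * freq a b (q + 1) ^ (-3 * α) := by positivity
  have e0 : freq a b q ^ (-β) * freq a b q = freq a b q ^ (1 - β) := by
    rw [rpow_mul_self_eq hf0]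
    congr 1
    ring
  have e1 : freq a b (q + 1) ^ (-1 - β + 7 * α) * freq a b (q + 1) ^ (-3 * α) =
      freq a b (q + 1) ^ (-β) * freq a b (q + 1) ^ (-1 + 4 * α) := by
    rw [← Real.rpow_add hf1, ← Real.rpow_add hf1]
    congr 1
    ring
  have e2 : freq a b (q + 2) ^ (2 * β) * freq a b (q + 2) ^ (-2 * β) = 1 := by
    rw [← Real.rpow_add hf2, show 2 * β + -2 * β = 0 by ring, Real.rpow_zero]
  calc C * (freq a b (q + 1) ^ (-β) * freq a b q ^ (-β) * freq a b q *
          freq a b (q + 1) ^ (-1 + 4 * α))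
      = C * ((freq a b q ^ (-β) * freq a b q) *
          (freq a b (q + 1) ^ (-β) * freq a b (q + 1) ^ (-1 + 4 * α))) * 1 := by ring
    _ = C * (freq a b q ^ (1 - β) *
          (freq a b (q + 1) ^ (-1 - β + 7 * α) * freq a b (q + 1) ^ (-3 * α))) *
          (freq a b (q + 2) ^ (2 * β) * freq a b (q + 2) ^ (-2 * β)) := by rw [e0, e1, e2]
    _ = (C * (freq a b q ^ (1 - β) * freq a b (q + 1) ^ (-1 - β + 7 * α) *
          freq a b (q + 2) ^ (2 * β))) *
          (freq a b (q + 2) ^ (-2 * β) * freq a b (q + 1) ^ (-3 * α)) := by ring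
    _ ≤ 1 * (freq a b (q + 2) ^ (-2 * β) * freq a b (q + 1) ^ (-3 * α)) :=
        mul_le_mul_of_nonneg_right key hW.le
    _ = freq a b (q + 2) ^ (-2 * β) * freq a b (q + 1) ^ (-3 * α) := one_mul _

/-- (2.6) at stage `q+1` from (2.24c) = Prop. 6.2 (§2.6: "an entirely analogous argument shows
(2.6) from (2.24c)"): if the `a`-exponent `(1-β+2α) + b(-1-β) + 2βb²` is negative, then
`C δ_q^{1/2} δ_{q+1}^{1/2} λ_q^{1+2α} λ_{q+1}^{-1} ≤ δ_{q+2}/4` for all `q` once `a` is large.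
[cite: BuckmasterEtAl2018, §2.6 (2.25)–(2.26)] -/
theorem exists_threshold_energy (hb : 1 ≤ b)
    (hE : (1 - β + 2 * α) + b * (-1 - β) + b ^ 2 * (2 * β) < 0) (C : ℝ) :
    ∃ a₁ : ℝ, 1 < a₁ ∧ ∀ a : ℝ, a₁ ≤ a → ∀ q : ℕ,
      C * (Real.sqrt (amp β a b q) * Real.sqrt (amp β a b (q + 1)) * freq a b q ^ (1 + 2 * α) *
          (freq a b (q + 1))⁻¹) ≤
        amp β a b (q + 1 + 1) / 4 := by
  obtain ⟨a₁, ha₁, h⟩ := exists_freq_triple_le hb hE (4 * C)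
  refine ⟨a₁, ha₁, fun a ha q => ?_⟩
  have ha1 : (1 : ℝ) ≤ a := by linarith
  have hf0 := freq_pos (b := b) ha1 q
  have hf1 := freq_pos (b := b) ha1 (q + 1)
  have hf2 := freq_pos (b := b) ha1 (q + 2)
  have key := h a ha q
  rw [sqrt_amp ha1, sqrt_amp ha1, show q + 1 + 1 = q + 2 from rfl, ← Real.rpow_neg_one]
  unfold amp
  have hW : 0 < freq a b (q + 2) ^ (-2 * β) / 4 := by positivity
  have e0 : freq a b q ^ (-β) * freq a b q ^ (1 + 2 * α) = freq a b q ^ (1 - β + 2 * α) := by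
    rw [← Real.rpow_add hf0]
    congr 1
    ring
  have e1 : freq a b (q + 1) ^ (-β) * freq a b (q + 1) ^ (-1 : ℝ) =
      freq a b (q + 1) ^ (-1 - β) := by
    rw [← Real.rpow_add hf1]
    congr 1
    ring
  have e2 : freq a b (q + 2) ^ (2 * β) * freq a b (q + 2) ^ (-2 * β) = 1 := by
    rw [← Real.rpow_add hf2, show 2 * β + -2 * β = 0 by ring, Real.rpow_zero]
  calc C * (freq a b q ^ (-β) * freq a b (q + 1) ^ (-β) * freq a b q ^ (1 + 2 * α) *
          freq a b (q + 1) ^ (-1 : ℝ))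
      = C * ((freq a b q ^ (-β) * freq a b q ^ (1 + 2 * α)) *
          (freq a b (q + 1) ^ (-β) * freq a b (q + 1) ^ (-1 : ℝ))) * 1 := by ring
    _ = C * (freq a b q ^ (1 - β + 2 * α) * freq a b (q + 1) ^ (-1 - β)) *
          (freq a b (q + 2) ^ (2 * β) * freq a b (q + 2) ^ (-2 * β)) := by rw [e0, e1, e2]
    _ = (4 * C * (freq a b q ^ (1 - β + 2 * α) * freq a b (q + 1) ^ (-1 - β) *
          freq a b (q + 2) ^ (2 * β))) * (freq a b (q + 2) ^ (-2 * β) / 4) := by ring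
    _ ≤ 1 * (freq a b (q + 2) ^ (-2 * β) / 4) := mul_le_mul_of_nonneg_right key hW.le
    _ = freq a b (q + 2) ^ (-2 * β) / 4 := one_mul _

/-- **The parameter inequalities of the proof of Prop. 2.1.** Let `0 < β < 1`, `1 < b` with
`E₀ := (2βb - (1-β))(b-1)` (the left side of (2.26) at `α = 0`, factorised; it is negative exactly
when `b < (1-β)/(2β)`, which is (2.1)′); let `0 < α` with `8αb < -E₀` (so (2.26) holds with room),
`M > 0` and `C` arbitrary. Then there is `a₁ > 1` such that for all `a ≥ a₁` and all `q`:
`C λ_q^{-α} ≤ M/16`; `(3C+2M) δ_q^{1/2} λ_q ≤ (M/4) δ_{q+1}^{1/2} λ_{q+1}`;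
`(M+1) δ_{q+1}^{1/2} ≤ δ_q^{1/2}`; `C δ_{q+1}^{1/2} δ_q^{1/2} λ_q λ_{q+1}^{-1+4α} ≤ δ_{q+2} λ_{q+1}^{-3α}`;
`C δ_q^{1/2} δ_{q+1}^{1/2} λ_q^{1+2α} λ_{q+1}^{-1} ≤ δ_{q+2}/4`; `λ_{q+1}^{-α} ≤ 1/4` — the
inequalities by which §2.6 derives (2.7) and (2.3)–(2.6) at stage `q+1` from (2.12), (2.13),
(2.18), (2.19), (2.23), (2.24), (2.24c). [cite: BuckmasterEtAl2018, §2.6 (Proof of Proposition 2.1)] -/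
theorem exists_mainThreshold (hβ : 0 < β) (hβ1 : β < 1) (hb : 1 < b)
    (hα : 0 < α) (hα8 : 8 * α * b < -((2 * β * b - (1 - β)) * (b - 1))) (hM : 0 < M) (C : ℝ) :
    ∃ a₁ : ℝ, 1 < a₁ ∧ ∀ a : ℝ, a₁ ≤ a → ∀ q : ℕ,
      C * freq a b q ^ (-α) ≤ M / 16 ∧
      (3 * C + 2 * M) * (Real.sqrt (amp β a b q) * freq a b q) ≤
        M / 4 * (Real.sqrt (amp β a b (q + 1)) * freq a b (q + 1)) ∧
      (M + 1) * Real.sqrt (amp β a b (q + 1)) ≤ Real.sqrt (amp β a b q) ∧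
      C * (Real.sqrt (amp β a b (q + 1)) * Real.sqrt (amp β a b q) * freq a b q *
          freq a b (q + 1) ^ (-1 + 4 * α)) ≤
        amp β a b (q + 1 + 1) * freq a b (q + 1) ^ (-3 * α) ∧
      C * (Real.sqrt (amp β a b q) * Real.sqrt (amp β a b (q + 1)) * freq a b q ^ (1 + 2 * α) *
          (freq a b (q + 1))⁻¹) ≤ amp β a b (q + 1 + 1) / 4 ∧
      freq a b (q + 1) ^ (-α) ≤ 1 / 4 := by
  have hb0 : (0 : ℝ) < b := by linarith
  have hαb : 0 < α * b := mul_pos hα hb0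
  have hE4 : (1 - β) + b * (-1 - β + 7 * α) + b ^ 2 * (2 * β) < 0 := by nlinarith
  have hE5 : (1 - β + 2 * α) + b * (-1 - β) + b ^ 2 * (2 * β) < 0 := by nlinarith
  obtain ⟨a1, ha1, h1⟩ := exists_threshold_rpow_neg hb.le hα hM C
  obtain ⟨a2, ha2, h2⟩ := exists_threshold_velocity (β := β) hβ1 hb hM C
  obtain ⟨a3, ha3, h3⟩ := exists_threshold_sqrt_amp hβ hb M
  obtain ⟨a4, ha4, h4⟩ := exists_threshold_stress hb.le hE4 C
  obtain ⟨a5, ha5, h5⟩ := exists_threshold_energy hb.le hE5 C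
  obtain ⟨a6, ha6, h6⟩ := exists_threshold_rpow_neg_succ hb.le hα
  refine ⟨max (max (max a1 a2) (max a3 a4)) (max a5 a6),
    lt_max_of_lt_left (lt_max_of_lt_left (lt_max_of_lt_left ha1)), fun a ha q => ?_⟩
  have h12 := le_of_max_le_left (le_of_max_le_left ha)
  have h34 := le_of_max_le_right (le_of_max_le_left ha)
  have h56 := le_of_max_le_right ha
  exact ⟨h1 a (le_of_max_le_left h12) q, h2 a (le_of_max_le_right h12) q,
    h3 a (le_of_max_le_left h34) q, h4 a (le_of_max_le_right h34) q,
    h5 a (le_of_max_le_left h56) q, h6 a (le_of_max_le_right h56) q⟩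

end Thresholds

end BDSV

end Literature.Analysis.FluidPDE
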